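import Mathlib.Algebra.MonoidAlgebra.Basic
import Mathlib.RingTheory.Ideal.Span
import Mathlib.RingTheory.Ideal.Operations
import Mathlib.Algebra.BigOperators.Fin
import HarnessLib

/-!
# Initial forms and initial ideals `in_w(I)` with respect to a weight (constant coefficients)

Definition item `defn-InitialIdeal` (topic `Literature/AlgebraicGeometry/Tropical`), requested by route
`ResolutionOfSingularities/TropicalLinks`, whose items (SchonPlus / InductiveStep / SchonResolves /
SchonLowDim) INLINE the initial ideal of an ideal `I` of the Laurent polynomial ring
`k[x₁^±, …, x_N^±] = AddMonoidAlgebra k (Fin N → ℤ)` with respect to an integer weight `w ∈ ℤ^N` as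
`Ideal.span ((fun f => AddMonoidAlgebra.ofCoeff (f.coeff.filter fun v => ∀ u ∈ f.coeff.support,
∑ i, w i * v i ≤ ∑ i, w i * u i)) '' (I : Set _))`. This file names that notion
(`weightInitialIdeal w I`, DEFINITIONALLY the displayed term: `weightInitialIdeal_eq_span` is `rfl`)
as the case `φ = ⟨w, ·⟩` of the general

* `initialForm φ f` — for a weight map `φ : M → Λ` into a linear order and `f ∈ k[M]`
  (`AddMonoidAlgebra k M`): the INITIAL FORM `in_φ(f)`, the sum of the terms `c_u x^u` of `f` whose
  weight `φ u` is MINIMAL among the exponents of `f` (the min-convention of tropical geometry: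
  Maclagan–Sturmfels, §2.4, `in_w(f) = Σ_{w·u minimal} c_u x^u` for constant coefficients / trivial
  valuation; Sturmfels 1996, Ch. 1, uses the opposite (max) convention `in_ω`, i.e. `in_{-w}` here);
* `initialIdeal φ I = ⟨in_φ(f) : f ∈ I⟩` — the INITIAL IDEAL (loc. cit.; for Laurent ideals
  Maclagan–Sturmfels, §2.6);
* `dotWeight w v = Σ wᵢ vᵢ` on `ℤ^N` and `weightInitialIdeal w I = initialIdeal (dotWeight w) I`.

## Proved API

`coeff_initialForm_apply`, `support_initialForm`; `initialForm_of_forall_eq` (a weight constant on the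
support changes nothing) hence `initialForm_const`, **`initialIdeal_const` / `weightInitialIdeal_zero`
(`in_0(I) = I`)**; `initialForm_single` (monomials are their own initial forms); `initialForm_ne_zero`
(a nonzero `f` has a nonzero initial form — the minimum over the finite support is attained);
**homogeneity** `weight_eq_of_mem_support_initialForm` (all exponents of `in_φ(f)` have the same
weight, the minimal one) and idempotence `initialForm_initialForm`; `initialForm_mem_initialIdeal`,
`initialIdeal_mono`, `initialIdeal_bot`, `initialIdeal_top`; over a GROUP `M` (Laurent polynomials)
monomials with unit coefficient are units (`isUnit_single`), so **an ideal is `⊤` iff it contains such a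
monomial** (`ideal_eq_top_iff_exists_single_mem`, in particular for `in_φ(I)`:
`initialIdeal_eq_top_iff`) — the criterion "`w ∈ Trop(V(I))` iff `in_w(I)` contains no monomial" reads
`in_w(I) ≠ ⊤`.

## What is NOT here (deliberately; no named fact is introduced)

The GRÖBNER FAN: that `w ↦ in_w(I)` takes finitely many values on `ℤ^N`, with fibres the relatively
open cones of a complete rational polyhedral fan, and that `in_w(I)` is `w'`-homogeneous for `w'` in
the span of the cone of `w` (Mora–Robbiano 1988; Sturmfels 1996, Ch. 1–2 for term orders and for
homogeneous ideals; Maclagan–Sturmfels 2015, §2.5 (Gröbner complex of a homogeneous ideal) and §2.6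
(Laurent ideals through homogenisation)). For INHOMOGENEOUS ideals and weights of both signs the
printed statements need care (the restricted Gröbner fan of an inhomogeneous polynomial ideal need
not be regular, Jensen 2007), and the Laurent/integer-weight form wanted by the route is obtained in
print only through the homogenisation of Maclagan–Sturmfels §2.6, which is not held (acquisition
request acq-06520); it should be vendored as a separate cite fact with that locator once read. Also
not here: initial forms over a VALUED field (`val(c_u) + w·u`), term orders, Gröbner bases.

## References

* D. Maclagan, B. Sturmfels, *Introduction to Tropical Geometry*, GSM 161, AMS 2015, §2.4 (initial
  forms and initial ideals, min-convention), §2.5–2.6 (Gröbner complex; Laurent ideals).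
  [MaclaganSturmfels2015]
* B. Sturmfels, *Gröbner Bases and Convex Polytopes*, ULS 8, AMS 1996, Ch. 1–2 (max-convention
  `in_ω`; Gröbner fan). [Sturmfels1996GBCP]
* T. Mora, L. Robbiano, *The Gröbner fan of an ideal*, J. Symb. Comput. 6 (1988) 183–208.
* A. N. Jensen, *A non-regular Gröbner fan*, Discrete Comput. Geom. 37 (2007) 443–453
  (arXiv:math/0501352).
-/

noncomputable section

open AddMonoidAlgebra

namespace Literature.AlgebraicGeometry.Tropical

universe u v w

section InitialForm

variable {k : Type u} [Semiring k] {M : Type v} {Λ : Type w} [LinearOrder Λ]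

/-- The **initial form** `in_φ(f)` of `f = Σ c_u x^u ∈ k[M]` with respect to the weight map
`φ : M → Λ`: the sum of the terms `c_u x^u` of `f` with `φ u` minimal among the exponents `u` of `f`
(min-convention, constant coefficients). [cite: MaclaganSturmfels2015, §2.4] -/
def initialForm (φ : M → Λ) (f : AddMonoidAlgebra k M) : AddMonoidAlgebra k M :=
  .ofCoeff (f.coeff.filter fun v => ∀ u ∈ f.coeff.support, φ v ≤ φ u)

/-- The coefficients of the initial form: `c_v` if `φ v` is minimal on the support, else `0`.
[folklore] -/
theorem coeff_initialForm_apply (φ : M → Λ) (f : AddMonoidAlgebra k M) (v : M) :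
    (initialForm φ f).coeff v = if ∀ u ∈ f.coeff.support, φ v ≤ φ u then f.coeff v else 0 :=
  Finsupp.filter_apply _ _ _

/-- The exponents of the initial form: those exponents of `f` of minimal weight. [folklore] -/
theorem support_initialForm (φ : M → Λ) (f : AddMonoidAlgebra k M) :
    (initialForm φ f).coeff.support =
      f.coeff.support.filter fun v => ∀ u ∈ f.coeff.support, φ v ≤ φ u :=
  Finsupp.support_filter _ _

/-- The exponents of `in_φ(f)` are exponents of `f`. [folklore] -/
theorem support_initialForm_subset (φ : M → Λ) (f : AddMonoidAlgebra k M) :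
    (initialForm φ f).coeff.support ⊆ f.coeff.support := by
  rw [support_initialForm]
  exact Finset.filter_subset _ _

/-- `in_φ(0) = 0`. [folklore] -/
@[simp] theorem initialForm_zero (φ : M → Λ) : initialForm φ (0 : AddMonoidAlgebra k M) = 0 := by
  unfold initialForm
  rw [coeff_zero, Finsupp.filter_zero]
  rfl

/-- If the weight is constant on the exponents of `f`, then `in_φ(f) = f`. [folklore] -/
theorem initialForm_of_forall_eq {φ : M → Λ} {f : AddMonoidAlgebra k M}
    (h : ∀ u ∈ f.coeff.support, ∀ v ∈ f.coeff.support, φ u = φ v) : initialForm φ f = f := by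
  unfold initialForm
  conv_rhs => rw [← ofCoeff_coeff f]
  congr 1
  rw [Finsupp.filter_eq_self_iff]
  intro v hv u hu
  exact (h v (Finsupp.mem_support_iff.2 hv) u hu).le

/-- For a CONSTANT weight every form is initial: `in_c(f) = f`. [folklore] -/
@[simp] theorem initialForm_const (c : Λ) (f : AddMonoidAlgebra k M) :
    initialForm (fun _ : M => c) f = f :=
  initialForm_of_forall_eq fun _ _ _ _ => rfl

/-- A monomial is its own initial form: `in_φ(c x^m) = c x^m`. [folklore] -/
@[simp] theorem initialForm_single (φ : M → Λ) (m : M) (c : k) :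
    initialForm φ (single m c) = single m c := by
  refine initialForm_of_forall_eq fun u hu v hv => ?_
  rw [coeff_single] at hu hv
  have hu' := Finset.mem_singleton.1 (Finsupp.support_single_subset hu)
  have hv' := Finset.mem_singleton.1 (Finsupp.support_single_subset hv)
  rw [hu', hv']

/-- **HOMOGENEITY of the initial form**: all exponents of `in_φ(f)` have the same weight (namely the
minimal weight of an exponent of `f`). [cite: MaclaganSturmfels2015, §2.4] -/
theorem weight_eq_of_mem_support_initialForm (φ : M → Λ) (f : AddMonoidAlgebra k M) {u v : M}
    (hu : u ∈ (initialForm φ f).coeff.support) (hv : v ∈ (initialForm φ f).coeff.support) :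
    φ u = φ v := by
  rw [support_initialForm, Finset.mem_filter] at hu hv
  exact le_antisymm (hu.2 v hv.1) (hv.2 u hu.1)

/-- An exponent of `in_φ(f)` has weight at most that of every exponent of `f`. [folklore] -/
theorem weight_le_of_mem_support_initialForm (φ : M → Λ) (f : AddMonoidAlgebra k M) {u v : M}
    (hu : u ∈ (initialForm φ f).coeff.support) (hv : v ∈ f.coeff.support) : φ u ≤ φ v := by
  rw [support_initialForm, Finset.mem_filter] at hu
  exact hu.2 v hv

/-- Taking initial forms is idempotent: `in_φ(in_φ(f)) = in_φ(f)`. [folklore] -/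
theorem initialForm_initialForm (φ : M → Λ) (f : AddMonoidAlgebra k M) :
    initialForm φ (initialForm φ f) = initialForm φ f :=
  initialForm_of_forall_eq fun _ hu _ hv => weight_eq_of_mem_support_initialForm φ f hu hv

/-- **A nonzero `f` has a nonzero initial form** (the minimal weight over the finite nonempty set of
exponents is attained). [folklore] -/
theorem initialForm_ne_zero (φ : M → Λ) {f : AddMonoidAlgebra k M} (hf : f ≠ 0) :
    initialForm φ f ≠ 0 := by
  have hne : f.coeff.support.Nonempty := by
    rw [Finsupp.support_nonempty_iff]
    intro h
    exact hf (by rw [← ofCoeff_coeff f, h]; rfl)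
  obtain ⟨v, hv, hmin⟩ := f.coeff.support.exists_min_image φ hne
  intro h0
  have hc : (initialForm φ f).coeff v = 0 := by rw [h0, coeff_zero, Finsupp.zero_apply]
  rw [coeff_initialForm_apply, if_pos hmin] at hc
  exact (Finsupp.mem_support_iff.1 hv) hc

/-- `in_φ(f) = 0 ↔ f = 0`. [folklore] -/
theorem initialForm_eq_zero_iff (φ : M → Λ) (f : AddMonoidAlgebra k M) :
    initialForm φ f = 0 ↔ f = 0 :=
  ⟨fun h => by_contra fun hf => initialForm_ne_zero φ hf h, fun h => by rw [h, initialForm_zero]⟩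

end InitialForm

section InitialIdeal

variable {k : Type u} [CommSemiring k] {M : Type v} [AddMonoid M] {Λ : Type w} [LinearOrder Λ]

/-- The **initial ideal** `in_φ(I) = ⟨in_φ(f) : f ∈ I⟩` of an ideal `I ⊆ k[M]` with respect to the
weight map `φ : M → Λ` (the ideal SPANNED by the initial forms of ALL elements of `I`; min-convention,
constant coefficients). [cite: MaclaganSturmfels2015, §2.4 and §2.6] -/
def initialIdeal (φ : M → Λ) (I : Ideal (AddMonoidAlgebra k M)) : Ideal (AddMonoidAlgebra k M) :=
  Ideal.span (initialForm φ '' (I : Set (AddMonoidAlgebra k M)))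

/-- The initial form of an element of `I` lies in `in_φ(I)`. [folklore] -/
theorem initialForm_mem_initialIdeal (φ : M → Λ) {I : Ideal (AddMonoidAlgebra k M)}
    {f : AddMonoidAlgebra k M} (hf : f ∈ I) : initialForm φ f ∈ initialIdeal φ I :=
  Ideal.subset_span ⟨f, hf, rfl⟩

/-- `in_φ` is monotone in the ideal. [folklore] -/
theorem initialIdeal_mono (φ : M → Λ) {I J : Ideal (AddMonoidAlgebra k M)} (h : I ≤ J) :
    initialIdeal φ I ≤ initialIdeal φ J :=
  Ideal.span_mono (Set.image_mono h)

/-- **`in_c(I) = I` for a constant weight** (in particular `in_0(I) = I`). [folklore] -/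
@[simp] theorem initialIdeal_const (c : Λ) (I : Ideal (AddMonoidAlgebra k M)) :
    initialIdeal (fun _ : M => c) I = I := by
  unfold initialIdeal
  have : initialForm (k := k) (fun _ : M => c) = id := funext (initialForm_const c)
  rw [this, Set.image_id, Ideal.span_eq]

/-- `in_φ(0) = 0`. [folklore] -/
@[simp] theorem initialIdeal_bot (φ : M → Λ) : initialIdeal φ (⊥ : Ideal (AddMonoidAlgebra k M)) = ⊥ := by
  unfold initialIdeal
  rw [Ideal.span_eq_bot]
  rintro _ ⟨f, hf, rfl⟩
  rw [(Submodule.mem_bot _).1 hf, initialForm_zero]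

/-- `in_φ(k[M]) = k[M]` (`1 = x^0` is a monomial, its own initial form). [folklore] -/
@[simp] theorem initialIdeal_top (φ : M → Λ) : initialIdeal φ (⊤ : Ideal (AddMonoidAlgebra k M)) = ⊤ := by
  rw [eq_top_iff]
  have h1 : (1 : AddMonoidAlgebra k M) ∈ initialIdeal φ (⊤ : Ideal (AddMonoidAlgebra k M)) := by
    have := initialForm_mem_initialIdeal φ (I := ⊤) (f := (1 : AddMonoidAlgebra k M)) trivial
    rwa [one_def, initialForm_single] at this
  exact fun x _ => by simpa using Ideal.mul_mem_left _ x h1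

end InitialIdeal

section Laurent

variable {k : Type u} [CommSemiring k] {M : Type v} [AddCommGroup M] {Λ : Type w} [LinearOrder Λ]

/-- In a Laurent polynomial ring `k[M]` (`M` a group) a monomial with unit coefficient is a unit:
`(c x^m)⁻¹ = c⁻¹ x^{-m}`. [folklore] -/
theorem isUnit_single {c : k} (hc : IsUnit c) (m : M) : IsUnit (single m c : AddMonoidAlgebra k M) := by
  obtain ⟨u, rfl⟩ := hc
  refine ⟨⟨single m (u : k), single (-m) ((u⁻¹ : kˣ) : k), ?_, ?_⟩, rfl⟩
  · rw [single_mul_single, add_neg_cancel, Units.mul_inv, ← one_def]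
  · rw [single_mul_single, neg_add_cancel, Units.inv_mul, ← one_def]

/-- **An ideal of a Laurent polynomial ring is the whole ring iff it contains a monomial with unit
coefficient** (over a field: a nonzero monomial). [folklore] -/
theorem ideal_eq_top_iff_exists_single_mem (J : Ideal (AddMonoidAlgebra k M)) :
    J = ⊤ ↔ ∃ (m : M) (c : k), IsUnit c ∧ single m c ∈ J := by
  constructor
  · rintro rfl
    exact ⟨0, 1, isUnit_one, trivial⟩
  · rintro ⟨m, c, hc, hm⟩
    exact Ideal.eq_top_of_isUnit_mem _ hm (isUnit_single hc m)

/-- In particular: **`in_φ(I) = ⊤` iff `in_φ(I)` contains a monomial with unit coefficient** — the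
complement of the tropical variety, `w ∉ Trop(V(I)) ⟺ in_w(I)` contains a monomial (here: a unit).
[cite: MaclaganSturmfels2015, §2.6] -/
theorem initialIdeal_eq_top_iff (φ : M → Λ) (I : Ideal (AddMonoidAlgebra k M)) :
    initialIdeal φ I = ⊤ ↔ ∃ (m : M) (c : k), IsUnit c ∧ single m c ∈ initialIdeal φ I :=
  ideal_eq_top_iff_exists_single_mem _

end Laurent

/-! ### Integer weights on the split torus `k[x₁^±, …, x_N^±]` -/

section Weight

variable {k : Type u} [CommSemiring k] {N : ℕ}

/-- The weight `⟨w, v⟩ = Σᵢ wᵢ vᵢ` of an exponent `v ∈ ℤ^N` for the weight vector `w ∈ ℤ^N`. [folklore] -/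
def dotWeight (w : Fin N → ℤ) (v : Fin N → ℤ) : ℤ := ∑ i, w i * v i

/-- Unfolding of `dotWeight`. [folklore] -/
theorem dotWeight_apply (w v : Fin N → ℤ) : dotWeight w v = ∑ i, w i * v i := rfl

/-- The zero weight vector weighs everything `0`. [folklore] -/
@[simp] theorem dotWeight_zero (v : Fin N → ℤ) : dotWeight (0 : Fin N → ℤ) v = 0 := by
  simp [dotWeight]

/-- `dotWeight w` is additive in the exponent. [folklore] -/
theorem dotWeight_add (w u v : Fin N → ℤ) : dotWeight w (u + v) = dotWeight w u + dotWeight w v := by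
  simp only [dotWeight, Pi.add_apply, mul_add, Finset.sum_add_distrib]

/-- **The initial ideal `in_w(I)` of an ideal of the Laurent polynomial ring
`k[x₁^±, …, x_N^±] = AddMonoidAlgebra k (Fin N → ℤ)` with respect to the integer weight `w ∈ ℤ^N`**
(min-convention): `initialIdeal (dotWeight w) I`. This is, definitionally, the term inlined by route
`ResolutionOfSingularities/TropicalLinks` (`weightInitialIdeal_eq_span`).
[cite: MaclaganSturmfels2015, §2.4 and §2.6] -/
abbrev weightInitialIdeal (w : Fin N → ℤ) (I : Ideal (AddMonoidAlgebra k (Fin N → ℤ))) :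
    Ideal (AddMonoidAlgebra k (Fin N → ℤ)) :=
  initialIdeal (dotWeight w) I

/-- `weightInitialIdeal w I` is LITERALLY the inlined term of the route (by `rfl`). [folklore] -/
theorem weightInitialIdeal_eq_span (w : Fin N → ℤ) (I : Ideal (AddMonoidAlgebra k (Fin N → ℤ))) :
    weightInitialIdeal w I =
      Ideal.span ((fun f : AddMonoidAlgebra k (Fin N → ℤ) =>
        AddMonoidAlgebra.ofCoeff (f.coeff.filter fun v =>
          ∀ u ∈ f.coeff.support, ∑ i, w i * v i ≤ ∑ i, w i * u i)) ''
        (I : Set (AddMonoidAlgebra k (Fin N → ℤ)))) :=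
  rfl

/-- **`in_0(I) = I`**. [folklore] -/
@[simp] theorem weightInitialIdeal_zero (I : Ideal (AddMonoidAlgebra k (Fin N → ℤ))) :
    weightInitialIdeal (0 : Fin N → ℤ) I = I := by
  have : dotWeight (0 : Fin N → ℤ) = fun _ => 0 := funext dotWeight_zero
  rw [weightInitialIdeal, this, initialIdeal_const]

end Weight

end Literature.AlgebraicGeometry.Tropical

end
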